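import Summits.BirchSwinnertonDyer.BirchSwinnertonDyer.Theorems.ThetaPartnerAtTwoKatoZetaErlKSideCMAtTwoSupplyOfDisplayedHondaPrimitiveCharValues
import Summits.BirchSwinnertonDyer.BirchSwinnertonDyer.Theorems.ThetaPartnerAtTwoSignedKatoUpToAtTwoKatoBKSocketKZ
import Summits.BirchSwinnertonDyer.BirchSwinnertonDyer.Theorems.ThetaPartnerAtTwoSignedKatoUpToAtTwoKatoBKBricks
import HarnessLib

/-!
# Route `ThetaPartnerAtTwo` (TP2), K2 column — C1 `KatoZetaErlKSideCMAtTwoSupply` (stmt-BirchSwinnertonDyer-28306, HOLD) from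
# «KATO'S VALUES ∧ THE K-SIDE DATUM» ALONE: Kobayashi's dictionary at `2` (Honda points, local variable, the P-side factorisation,
# the log character sums, the passage to congruences) is discharged by the tree — the `γ`-type twin of the K3 socket

Seat `bsd-input-kz-cm-two` g0 (literature-prover, cell `pub/bsd-wall/bsd-inputs`). Fourth file of the series `…OfDisplayedHonda` (T1) /
`…OfDisplayedHondaCharValues` (T2) / `…OfDisplayedHondaPrimitiveCharValues` (T3). HONEST FRAMING: one theorem, an implication displaying its
hypothesis; no definition, no named fact, no instance, no `sorry`; item 28306 is NOT closed; no summit statement (BSD) is proved by this file.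

## What is here

`katoZetaErlKSideCMAtTwoSupply_of_katoValuesKSide : hXγ → C1`. The hypothesis `hXγ` no longer mentions Honda points, the local generator or
Kurihara's pairing sums. For every KZ-context and every `2`-adic FRAME — model data `Φ : ℚ̄₂ ≃ₐ[ℚ] ℚ̄_v` over `φ`, `ι : ℚ̄ → ℚ̄₂` with
`closureEmb ℚ_v = Φ ∘ ι`, a coherent family of embeddings `e_k : ℚ(ζ_{2^k}) → ℚ̄₂` onto the tree's tower `zeta 2 k`, and Galois lifts `τ_{m,a}`
with `τ_{m,a} ζ_{2^m} = ζ_{2^m}^a` (all four EXIST in the tree: `SignedEC.exists_model_padic_adicCompletion`, `KatoBK.exists_algHom_cyclotomicField_zeta_eq`,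
`KatoBK.exists_tau_two`) — it asks for a class `s ∈ 𝐇¹_Γ(T₂A)`, values `x_k ∈ ℚ(ζ_{2^k})`, a constant `q ∈ ℚˣ`, an integer `t₀` and a multiplier
`μt ∈ Λ ∖ 𝔭′` with `μt(0) = t₀`, such that
* (BK) the layer-`n` local Tate pairing of `proj_n s` with every formal point `Q` of `E(ℚ_{n,v})` is `Σ_b τ_b•(log_ω Q̃ · e_{n+2} x_{n+2})`
  [Bloch–Kato 1990 §3 / Kato Thm. 12.5 (1) via Thm. 9.7 + 6.6: `⟨z, ∂Q⟩ = Tr(log_ω Q · exp*_ω z)`; Kobayashi (8.29), Prop. 8.25];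
* (VAL) for every even PRIMITIVE Dirichlet character `ψ` mod `2^{n+2}` (values in `ℚ̄₂`), pushed to `ℂ₂`:
  `(Σ_b ψ̄(b) τ_b•e_{n+2}x_{n+2}) · g(ψ) = q · μt(ψ(5) − 1) · Σ_a ψ(a)[a/2^{n+2}]⁺_{f_A}` [Kato Thm. 12.5 (1) for the CM form `f_A` (§15.16) at the
  `γ`-type element behind `s` ((15.16.1)), Birch's formula; the Λ-multiplier `μt` carries the twist `N𝔞 − σ_𝔞` of the elliptic zeta element
  ((15.6.3)) and the `2`-power making `s` integral];
* (TRIV) at the trivial character of levels `4, 8`: `Σ_σ σ(x_k) = (3/2)·q·t₀·[0]⁺_{f_A}` [Kato Thm. 12.5 (1), depleted Euler factor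
  `1 − a₂/2 + 1/2 = 3/2` at `a₂ = 0`];
* `Nonempty (KatoDescent.KSideDatum I Y s 𝔭′)` [Kato §15, JLK Thm. 5.7 §7.2].

Proof = the `γ`-type re-cut of the K3 socket `KatoBK.corePairChiPrim_of_coreKZ_of_bricks` (all steps CM-blind tree lemmas): displayed Honda
data and local variable (`PlusLayer.plusHondaSystemTwo_adicCompletion_withLog`, `LocalVar.exists_localVariable_two` — supplied by T3's
binder), the P-side factorisation `KatoBK.sum_pow_mul_trace_eq_mul` (Kobayashi Prop. 8.25), the log character sums
`LocalVar.sum_pow_mul_ptLogΩ_pow_smul_plusHondaPoint_eq` (Prop. 8.26 shape at `2`) and `KatoBK.logBaseTwo_brick`, the Hecke base cases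
`KatoBK.heckeBaseTwo_brick`, `KatoBK.level_identity_trivial` at the trivial character, and `ν := C(q.den)`, `μ := C(3 q.num)·μt`; then T3.

References: [Kato2004Asterisque] Thm. 6.6, Thm. 9.7, Thm. 12.5 (1) (p. 221), §15.6 (15.6.3) (p. 254), §15.16 and (15.16.1) (p. 265);
[BlochKato1990] §3 (3.10.1), (3.11); [Kobayashi2003] (8.23) (p. 18), (8.29), Prop. 8.25–8.26, proof of Thm. 6.3 (pp. 24–25);
[MazurTateTeitelbaum1986Invent] §I.4, §I.13; [JohnsonLeungKings2011] Thm. 5.7, §7.2.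
-/

set_option autoImplicit false
-- the Theorems namespace of this sub repeats the summit name by design (D-0017 nested layout)
set_option linter.dupNamespace false

noncomputable section

set_option backward.isDefEq.respectTransparency false

open scoped Classical NumberField MatrixGroups ModularForm TensorProduct

open NumberField IsDedekindDomain CongruenceSubgroup WeierstrassCurve Field Literature Literature.NumberTheory.EllipticCurves
  Literature.NumberTheory.GaloisRepresentations Literature.NumberTheory.EllipticCurves.ModularForms
  Literature.NumberTheory.EllipticCurves.Rank1Residual Literature.NumberTheory.EllipticCurves.IwasawaDual
  Literature.NumberTheory.EllipticCurves.Kobayashi2003 Literature.NumberTheory.EllipticCurves.Module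
  Literature.NumberTheory.EllipticCurves.Kato2004 Literature.NumberTheory.EllipticCurves.Kato2004.EulerSystemValues
  Literature.NumberTheory.EllipticCurves.GreenbergSelmer Literature.NumberTheory.EllipticCurves.Sprung2012
  Literature.NumberTheory.EllipticCurves.FormalGroupChart
  ZpExtension Summit.BirchSwinnertonDyer.Rank1Residual.Supersingular
  Summit.BirchSwinnertonDyer.Rank1Residual.Additive Summit.BirchSwinnertonDyer.Rank1Residual.Additive.PadicCyclotomicTower
  Summit.BirchSwinnertonDyer.Rank1Residual.Additive.BallEval Summit.BirchSwinnertonDyer.Rank1Residual.Additive.LocalTransport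
  Summit.BirchSwinnertonDyer.BirchSwinnertonDyer.Theorems.SignedKatoOffTwo
  Summit.BirchSwinnertonDyer.BirchSwinnertonDyer.Theorems.SignedKatoOffTwo.LocalTwo
  Summit.BirchSwinnertonDyer.BirchSwinnertonDyer.Theorems.SignedKatoOffTwo.KatoBK

namespace Summit.BirchSwinnertonDyer.BirchSwinnertonDyer.Theorems.KatoZetaErlKSideCMAtTwo

open Rat.HeightOneSpectrum

set_option maxHeartbeats 800000 in
/-- **C1 BY NAME ⟸ Kato's values ∧ the K-side datum (the `γ`-type socket for the CM form at `2`).** See the module docstring for the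
hypothesis `hXγ` = (BK) ∧ (VAL) ∧ (TRIV) ∧ `Nonempty (KSideDatum I Y s 𝔭′)` on an arbitrary `2`-adic frame `(Φ, φ, ι, e, τ)`, and for the
proof (Kobayashi's dictionary at `2` from the tree, then T3). CONDITIONAL on `hXγ` (published input: Kato 2004 Thm. 12.5 (1) + §15.16/(15.16.1)
through Bloch–Kato for the pairing clause; Kato §15 / Johnson-Leung–Kings Thm. 5.7 §7.2 for the datum); closes nothing by itself; BSD is not
proved by this. [cite: Kato2004Asterisque, Thm. 12.5 (1) (p. 221), §15.16 and (15.16.1) (p. 265), (15.6.3) (p. 254)] [cite: BlochKato1990, §3 (3.10.1), (3.11)]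
[cite: Kobayashi2003, (8.23) (p. 18), Prop. 8.25–8.26 and proof of Thm. 6.3 (pp. 24–25)] [cite: JohnsonLeungKings2011, Thm. 5.7 and §7.2] -/
theorem katoZetaErlKSideCMAtTwoSupply_of_katoValuesKSide
    (hXγ :
      ∀ (v : HeightOneSpectrum (𝓞 ℚ)), ((2 : ℕ) : 𝓞 ℚ) ∈ v.asIdeal →
      ∀ (A : WeierstrassCurve ℚ) [A.IsElliptic] [A.IsGloballyMinimal],
        A.HasCM → A.analyticRank = 0 → GoodSS A 2 → A.frobeniusTrace 2 = 0 →
        2 ∣ A.shaOrder * A.tamagawaProduct →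
        ∀ (κ : ZpExtension ℚ 2) (γ : Field.absoluteGaloisGroup ℚ),
          κ.IsCyclotomic → κ.IsTopGenerator γ → IsCyclotomicVariable 2 γ →
        ∀ [NeZero (A.conductorNorm ℤ)] (f : CuspForm (Gamma0 (A.conductorNorm ℤ)) 2),
          IsNewformOf A f → ∀ (ϖ : ℚ), (ϖ : ℝ) * A.realPeriodRat = plusPeriod f →
        ∀ (Lplus Lminus : IwasawaAlgebra 2), IsPollackPair f 2 Lplus Lminus →
        ∀ [ContinuousSMul ℤ_[2] (A.tateModule 2)] (Y : A.FineSelmerDualData κ γ),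
        ∀ 𝔭' : PrimeSpectrum (IwasawaAlgebra 2), 𝔭'.asIdeal.height = 1 →
          PowerSeries.C (2 : ℤ_[2]) ∉ 𝔭'.asIdeal →
        ∀ (I : Kato2004.IwasawaH1Data A 2 κ γ)
          (pair : ∀ n : ℕ, H1 (tateRep A 2) (κ.layerSubgroup n) →ₗ[ℤ_[2]]
            (localLayerPointsOfEmb κ (closureEmb (K := ℚ) (v.adicCompletion ℚ)) A n →+ ℤ_[2])),
          (∀ (n : ℕ) (x : H1 (tateRep A 2) (κ.layerSubgroup (n + 1))) (Q : localPoints A (v.adicCompletion ℚ))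
            (hQ : Q ∈ localLayerPointsOfEmb κ (closureEmb (K := ℚ) (v.adicCompletion ℚ)) A n),
            pair n (layerCores (tateRep A 2) κ n x) ⟨Q, hQ⟩ =
              pair (n + 1) x ⟨Q, localLayerPointsOfEmb_mono κ (closureEmb (K := ℚ) (v.adicCompletion ℚ)) A (Nat.le_succ n) hQ⟩) →
          (∀ (n : ℕ) (g : Field.absoluteGaloisGroup (v.adicCompletion ℚ)) (y : H1 (tateRep A 2) (κ.layerSubgroup n))
            (Q : localPoints A (v.adicCompletion ℚ))
            (hQ : Q ∈ localLayerPointsOfEmb κ (closureEmb (K := ℚ) (v.adicCompletion ℚ)) A n),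
            pair n (conjMap (tateRep A 2).toTopRep (κ.layerSubgroup n) (resGalOfEmb (closureEmb (K := ℚ) (v.adicCompletion ℚ)) g) 1 y)
              ⟨g • Q, smul_mem_localLayerPointsOfEmb κ (closureEmb (K := ℚ) (v.adicCompletion ℚ)) A n g hQ⟩ = pair n y ⟨Q, hQ⟩) →
          (∀ (n k : ℕ) (x : H1 (tateRep A 2) (κ.layerSubgroup n))
            (Q : localLayerPointsOfEmb κ (closureEmb (K := ℚ) (v.adicCompletion ℚ)) A n),
            PadicInt.toZModPow k (pair n x Q) =
              LayerPairing.layerPairingPk A κ v (LayerPairing.weilTowerPk A) (LayerPairing.weilTowerPk_pow A)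
                (LayerPairing.weilTowerPk_add_left A) (LayerPairing.weilTowerPk_add_right A) (LayerPairing.weilTowerPk_smul A)
                n k x Q) →
        ∀ (Φ : AlgebraicClosure ℚ_[2] ≃ₐ[ℚ] AlgebraicClosure (v.adicCompletion ℚ)) (φ : ℚ_[2] ≃+* v.adicCompletion ℚ)
          (hΦφ : ∀ y : ℚ_[2], Φ (algebraMap ℚ_[2] (AlgebraicClosure ℚ_[2]) y) =
            algebraMap (v.adicCompletion ℚ) (AlgebraicClosure (v.adicCompletion ℚ)) (φ y))
          (ι : AlgebraicClosure ℚ →ₐ[ℚ] AlgebraicClosure ℚ_[2]),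
          (∀ z, closureEmb (K := ℚ) (v.adicCompletion ℚ) z = Φ (ι z)) →
        -- a coherent family of embeddings `ℚ(ζ_{2^k}) → ℚ̄₂` onto the tree's tower and Galois lifts `τ_{m,a} ζ_{2^m} = ζ_{2^m}^a`
        ∀ (e : ∀ k : ℕ, CyclotomicField (cycLevel 2 k ∅) ℚ →ₐ[ℚ] PadicAlgCl 2),
          (∀ k, e k (IsCyclotomicExtension.zeta (cycLevel 2 k ∅) ℚ (CyclotomicField (cycLevel 2 k ∅) ℚ)) = zeta 2 k) →
        ∀ (τ : ∀ m : ℕ, ZMod (2 ^ m) → Field.absoluteGaloisGroup ℚ_[2]),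
          (∀ (m : ℕ) (a : ZMod (2 ^ m)), IsUnit a → τ m a • zeta 2 m = zeta 2 m ^ a.val) →
        ∃ (s : I.H) (x : ∀ k : ℕ, CyclotomicField (cycLevel 2 k ∅) ℚ) (q : ℚ) (t₀ : ℤ) (μt : IwasawaAlgebra 2),
          q ≠ 0 ∧ μt ∉ 𝔭'.asIdeal ∧ PowerSeries.coeff 0 μt = (t₀ : ℤ_[2]) ∧
          -- (BK) the layer Tate pairing of `proj_n s` with formal points is the trace of `log_ω · e(x)`
          (haveI := isIntegral_genFib_baseChange 2 ((integralModelInt A).map (Int.castRingHom ℤ_[2]))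
           ∀ (n : ℕ) (Q₀ : localPoints A ℚ_[2])
            (hQv : WeierstrassCurve.Affine.Point.map (W' := A)
                (Φ : AlgebraicClosure ℚ_[2] →ₐ[ℚ] AlgebraicClosure (v.adicCompletion ℚ))
                (show (A.baseChange (AlgebraicClosure ℚ_[2])).toAffine.Point from Q₀) ∈
              localLayerPointsOfEmb κ (closureEmb (K := ℚ) (v.adicCompletion ℚ)) A n),
            (toLoc ((genFibΩ_eq_baseChange ((integralModelInt A).map (Int.castRingHom ℤ_[2]))).trans
              (baseChange_twoAdicModel A))).symm Q₀ ∈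
              kernel (Valued.v (R := PadicAlgCl 2)) (genFibΩ 2 ((integralModelInt A).map (Int.castRingHom ℤ_[2]))) →
            algebraMap ℚ_[2] (PadicAlgCl 2) ((pair n (I.proj n s) ⟨_, hQv⟩ : ℤ_[2]) : ℚ_[2]) =
              ∑ b : (ZMod (2 ^ (n + 2)))ˣ, τ (n + 2) (b : ZMod (2 ^ (n + 2))) •
                (ptLogΩ 2 ((integralModelInt A).map (Int.castRingHom ℤ_[2]))
                    ((toLoc ((genFibΩ_eq_baseChange ((integralModelInt A).map (Int.castRingHom ℤ_[2]))).trans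
                      (baseChange_twoAdicModel A))).symm Q₀) *
                  e (n + 2) (x (n + 2)))) ∧
          -- (VAL) Kato's values at the even primitive characters, pushed to `ℂ₂`, with the Λ-multiplier `μt`
          (∀ (n : ℕ) (ψ : DirichletCharacter (PadicAlgCl 2) (2 ^ (n + 2))), ψ (-1) = 1 → ψ.IsPrimitive →
            algebraMap (PadicAlgCl 2) ℂ_[2]
                ((∑ b : (ZMod (2 ^ (n + 2)))ˣ, ψ⁻¹ (b : ZMod (2 ^ (n + 2))) * τ (n + 2) (b : ZMod (2 ^ (n + 2))) • e (n + 2) (x (n + 2))) *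
                  gaussSum ψ (AddChar.zmodChar (2 ^ (n + 2)) (HondaLog.zeta_pow_prime_pow_self (p := 2) (n + 2)))) =
              (q : ℂ_[2]) *
                (∑' k, ((algebraMap ℚ_[2] ℂ_[2]).comp (algebraMap ℤ_[2] ℚ_[2])) (PowerSeries.coeff k μt) *
                    (algebraMap (PadicAlgCl 2) ℂ_[2] (ψ (5 : ZMod (2 ^ (n + 2)))) - 1) ^ k) *
                ratTwistedSymbolSum f (ψ.ringHomComp (algebraMap (PadicAlgCl 2) ℂ_[2]))) ∧
          -- (TRIV) Kato's values at the trivial character of levels `4` and `8`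
          (∀ k : ℕ, 2 ≤ k → k ≤ 3 →
            ∑ b : (ZMod (cycLevel 2 k (∅ : Finset (HeightOneSpectrum (𝓞 ℚ)))))ˣ,
                sigma (cycLevel 2 k (∅ : Finset (HeightOneSpectrum (𝓞 ℚ)))) b (x k) =
              ((3 / 2 * q * t₀ * ratPlusSymbol f 0 : ℚ) : CyclotomicField (cycLevel 2 k (∅ : Finset (HeightOneSpectrum (𝓞 ℚ)))) ℚ)) ∧
          Nonempty (KatoDescent.KSideDatum I Y s 𝔭')) :
    Summit.BirchSwinnertonDyer.BirchSwinnertonDyer.Theses.ThetaPartnerAtTwo.KatoZetaErlKSideCMAtTwoSupply := by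
  refine katoZetaErlKSideCMAtTwoSupply_of_primCharValuesKSideOnDisplayedHonda
    fun v hv A _ _ hcm hr hss ha h2 κ γ hκ hγ hcv _ f hf ϖ hϖ Lplus Lminus hPP _ Y 𝔭' h𝔭' hp𝔭' I pair hP1 hP2 hP3 Φ φ hΦφ ι hι
      cc σσ d₀ d hcΩ hcstab hσσ hd₀ hd₀L hdT hL hTR hGEN hGEN0 g₀ g hgdef hgen₀ hgen hχ₀ hχ hζpow hroots hTg ↦ ?_
  -- newform bookkeeping
  have hf0 : IsNewform0 f := hf.1
  have hQ : coeffField f = ⊥ := hf.coeffField_eq_bot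
  have hN2 : ¬ 2 ∣ A.conductorNorm ℤ := not_dvd_level_of_isNewformOf hf hss.1
  have hap : cuspCoeff f 2 = 0 := by
    rw [cuspCoeff_eq_frobeniusTrace_of_isNewformOf_holds hf hss.1, ha]; simp
  -- the rest of the frame exists in the tree
  obtain ⟨e, he⟩ := exists_algHom_cyclotomicField_zeta_eq
  obtain ⟨τ, hτ⟩ := exists_tau_two
  obtain ⟨s, x, q, t₀, μt, hq0, hμt, hμt0, hBK, hVAL, hTRIV, hK⟩ :=
    hXγ v hv A hcm hr hss ha h2 κ γ hκ hγ hcv f hf ϖ hϖ Lplus Lminus hPP Y 𝔭' h𝔭' hp𝔭' I pair hP1 hP2 hP3 Φ φ hΦφ ι hι e he τ hτ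
  refine ⟨s, ⟨PowerSeries.C (((3 * q.num : ℤ) : ℤ_[2])) * μt, PowerSeries.C (((q.den : ℤ) : ℤ_[2])), ?_, ?_, ?_⟩, hK⟩
  · -- `μ ∉ 𝔭′`
    intro hmem
    rcases 𝔭'.isPrime.mem_or_mem hmem with h | h
    · exact C_intCast_not_mem_of_ne_zero 𝔭'.isPrime hp𝔭' (by
        have : q.num ≠ 0 := Rat.num_ne_zero.mpr hq0
        positivity) h
    · exact hμt h
  · -- `ν ∉ 𝔭′`
    exact C_intCast_not_mem_of_ne_zero 𝔭'.isPrime hp𝔭' (by exact_mod_cast q.den_ne_zero)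
  have hce : cyclotomicExponent 2 = 2 := rfl
  have hcg5 : cyclotomicGenerator 2 = 5 := rfl
  intro n
  rw [hce, hcg5]
  simp only [Nat.cast_ofNat]
  intro χ heven hord hprim'
  haveI : NeZero (2 ^ (n + 2)) := ⟨pow_ne_zero _ two_ne_zero⟩
  haveI : NeZero (2 ^ n) := ⟨pow_ne_zero _ two_ne_zero⟩
  haveI hintΩ := isIntegral_genFib_baseChange 2 ((integralModelInt A).map (Int.castRingHom ℤ_[2]))
  -- the orbit of logarithms of the displayed plus Honda point `d₀ n`
  have hk0 := @toLoc_symm_plusPoint_mem_kernel A _ cc σσ d₀ (fun m ↦ (hcΩ m).2.1) hd₀ n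
  obtain ⟨L, hLdef⟩ : ∃ L : ℕ → PadicAlgCl 2, L = fun j ↦ ptLogΩ 2 ((integralModelInt A).map (Int.castRingHom ℤ_[2]))
      ((toLoc ((genFibΩ_eq_baseChange ((integralModelInt A).map (Int.castRingHom ℤ_[2]))).trans
        (baseChange_twoAdicModel A))).symm (g₀ ^ j • d₀ n)) := ⟨_, rfl⟩
  have hLj : ∀ j, L j = g₀ ^ j • ptLogΩ 2 ((integralModelInt A).map (Int.castRingHom ℤ_[2]))
      ((toLoc ((genFibΩ_eq_baseChange ((integralModelInt A).map (Int.castRingHom ℤ_[2]))).trans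
        (baseChange_twoAdicModel A))).symm (d₀ n)) := fun j ↦ by
    rw [hLdef]; exact ptLogΩ_toLoc_symm_pow_smul A g₀ j (d₀ n) @hk0
  have hL0 : L 0 = ptLogΩ 2 ((integralModelInt A).map (Int.castRingHom ℤ_[2]))
      ((toLoc ((genFibΩ_eq_baseChange ((integralModelInt A).map (Int.castRingHom ℤ_[2]))).trans
        (baseChange_twoAdicModel A))).symm (d₀ n)) := by rw [hLj, pow_zero, one_smul]
  have hLorb : ∀ j, L j = g₀ ^ j • L 0 := fun j ↦ by rw [hLj j, hL0]
  have hL0mem : L 0 ∈ layer 2 (n + 2) := by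
    rw [hL0]; exact ptLogΩ_mem_layer A ι hκ n (d₀ n) (hd₀L n) @hk0
  have hLneg : ∀ a : ZMod (2 ^ (n + 2)), IsUnit a → τ (n + 2) (-a) • L 0 = τ (n + 2) a • L 0 := by
    intro a ha; rw [hL0]; exact tau_neg_smul_ptLogΩ_eq A ι hκ n (τ (n + 2)) (hτ (n + 2)) ha (d₀ n) (hd₀L n) @hk0
  have hg₀1 : g₀ • zeta 2 (n + 2) = zeta 2 (n + 2) ^ 5 := by simpa using hζpow (n + 2) 1
  -- the pairing values `V j = ⟨pair_n (proj_n s), gʲ d_n⟩`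
  have hmemv : ∀ j : ℕ, g ^ j • d n ∈ localLayerPointsOfEmb κ (closureEmb (K := ℚ) (v.adicCompletion ℚ)) A n :=
    fun j ↦ smul_mem_localLayerPointsOfEmb κ (closureEmb (K := ℚ) (v.adicCompletion ℚ)) A n (g ^ j) (hL n)
  obtain ⟨V, hVdef⟩ : ∃ V : ℕ → ℤ_[2], V = fun j ↦ pair n (I.proj n s) ⟨g ^ j • d n, hmemv j⟩ := ⟨_, rfl⟩
  have hpt : ∀ j : ℕ, (show localPoints A (v.adicCompletion ℚ) from
      WeierstrassCurve.Affine.Point.map (W' := A)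
        (Φ : AlgebraicClosure ℚ_[2] →ₐ[ℚ] AlgebraicClosure (v.adicCompletion ℚ))
        (show (A.baseChange (AlgebraicClosure ℚ_[2])).toAffine.Point from (g₀ ^ j • d₀ n))) = g ^ j • d n := by
    intro j
    have h := hTg A j (d₀ n)
    have h' := hdT n
    dsimp only at h h' ⊢
    rw [h, h']
  have hQv : ∀ j : ℕ, WeierstrassCurve.Affine.Point.map (W' := A)
        (Φ : AlgebraicClosure ℚ_[2] →ₐ[ℚ] AlgebraicClosure (v.adicCompletion ℚ))
        (show (A.baseChange (AlgebraicClosure ℚ_[2])).toAffine.Point from (g₀ ^ j • d₀ n)) ∈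
      localLayerPointsOfEmb κ (closureEmb (K := ℚ) (v.adicCompletion ℚ)) A n := by
    intro j
    have h := hpt j
    dsimp only at h
    rw [h]
    exact hmemv j
  have hkj : ∀ j : ℕ, (toLoc ((genFibΩ_eq_baseChange ((integralModelInt A).map (Int.castRingHom ℤ_[2]))).trans
      (baseChange_twoAdicModel A))).symm (g₀ ^ j • d₀ n) ∈
        kernel (Valued.v (R := PadicAlgCl 2)) (genFibΩ 2 ((integralModelInt A).map (Int.castRingHom ℤ_[2]))) :=
    fun j ↦ @toLoc_symm_smul_mem_kernel A _ (g₀ ^ j) (d₀ n) @hk0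
  have hV : ∀ j : ℕ, algebraMap ℚ_[2] (PadicAlgCl 2) (V j : ℚ_[2]) =
      ∑ b : (ZMod (2 ^ (n + 2)))ˣ, τ (n + 2) (b : ZMod (2 ^ (n + 2))) • (L j * e (n + 2) (x (n + 2))) := by
    intro j
    have h6 := hBK n (g₀ ^ j • d₀ n) (hQv j) (hkj j)
    have hsub : (⟨g ^ j • d n, hmemv j⟩ : localLayerPointsOfEmb κ (closureEmb (K := ℚ) (v.adicCompletion ℚ)) A n) =
        ⟨_, hQv j⟩ := Subtype.ext (hpt j).symm
    rw [hVdef]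
    dsimp only
    rw [hsub, h6, hLdef]
  -- `ν(χ(5)−1) = q.den`, `μ(χ(5)−1) = 3 q.num · μt(χ(5)−1)`, and the left sum is `Σ_j ι(V_j) χ(5)^j`
  have hz : ‖χ (5 : ZMod (2 ^ (n + 2))) - 1‖ < 1 := by
    have h := Literature.NumberTheory.EllipticCurves.norm_apply_cyclotomicGenerator_sub_one_lt χ hord
    simpa only [hcg5, Nat.cast_ofNat] using h
  have hμts : HasSum (fun k ↦ ((algebraMap ℚ_[2] ℂ_[2]).comp (algebraMap ℤ_[2] ℚ_[2])) (PowerSeries.coeff k μt) *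
      (χ (5 : ZMod (2 ^ (n + 2))) - 1) ^ k)
      (∑' k, ((algebraMap ℚ_[2] ℂ_[2]).comp (algebraMap ℤ_[2] ℚ_[2])) (PowerSeries.coeff k μt) *
        (χ (5 : ZMod (2 ^ (n + 2))) - 1) ^ k) :=
    (summable_map_coeff_mul_pow ((algebraMap ℚ_[2] ℂ_[2]).comp (algebraMap ℤ_[2] ℚ_[2]))
      (norm_algebraMap_coeff_le_one μt) hz).hasSum
  have hν := hasSum_cpCoeff_C (((q.den : ℤ) : ℤ_[2])) (χ (5 : ZMod (2 ^ (n + 2))) - 1)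
  have hμ := hasSum_cpCoeff_mul hz (hasSum_cpCoeff_C (((3 * q.num : ℤ) : ℤ_[2])) (χ (5 : ZMod (2 ^ (n + 2))) - 1)) hμts
  rw [hν.tsum_eq, hμ.tsum_eq, CoreChi.tsum_coeff_pairingSum_mul_pow_eq_sum]
  have hsum : ∑ j ∈ Finset.range (2 ^ n), ((algebraMap ℚ_[2] ℂ_[2]).comp (algebraMap ℤ_[2] ℚ_[2]))
        (evalOn A (localLayerPointsOfEmb κ (closureEmb (K := ℚ) (v.adicCompletion ℚ)) A n) (pair n (I.proj n s)) (g ^ j • d n)) *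
          χ (5 : ZMod (2 ^ (n + 2))) ^ j =
      ∑ j ∈ Finset.range (2 ^ n),
        algebraMap (PadicAlgCl 2) ℂ_[2] (algebraMap ℚ_[2] (PadicAlgCl 2) (V j : ℚ_[2])) * χ (5 : ZMod (2 ^ (n + 2))) ^ j := by
    refine Finset.sum_congr rfl fun j _ ↦ ?_
    rw [evalOn_of_mem (hP := hmemv j), hVdef, RingHom.comp_apply, IsScalarTower.algebraMap_apply ℚ_[2] (PadicAlgCl 2) ℂ_[2]]
    rfl
  rw [hsum, map_intCast, map_intCast]
  have hq : (q.den : ℂ_[2]) * (q : ℂ_[2]) = (q.num : ℂ_[2]) := by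
    rw [mul_comm]; exact_mod_cast Rat.mul_den_eq_num q
  by_cases hp : χ.IsPrimitive
  · -- PRIMITIVE χ: descend to `ψ` over `ℚ̄₂`, factorise (Prop. 8.25), read the logs (Prop. 8.26 shape) and Kato's values
    have hι₂inj : Function.Injective (algebraMap (PadicAlgCl 2) ℂ_[2]) := (algebraMap (PadicAlgCl 2) ℂ_[2]).injective
    have hχpow : ∀ a : (ZMod (2 ^ (n + 2)))ˣ, χ (a : ZMod (2 ^ (n + 2))) ^ 2 ^ (n + 2) = 1 := apply_pow_two_pow_eq_one n χ
    obtain ⟨ψ, hψ⟩ := exists_mulChar_ringHomComp_eq (algebraMap (PadicAlgCl 2) ℂ_[2]) hι₂inj (NeZero.pos _)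
      (isPrimitiveRoot_zeta 2 (n + 2)) χ hχpow
    have hχa : ∀ a : ZMod (2 ^ (n + 2)), χ a = algebraMap (PadicAlgCl 2) ℂ_[2] (ψ a) := fun a ↦ by
      rw [← hψ, MulChar.ringHomComp_apply]
    have hevenψ : ψ (-1) = 1 := hι₂inj (by rw [← hχa, heven, map_one])
    have hprimψ : DirichletCharacter.IsPrimitive ψ := by
      have h := hp
      rw [← hψ] at h
      exact (isPrimitive_ringHomComp_iff hι₂inj ψ).mp h
    -- P-side factorisation
    have hE1 : ∑ j ∈ Finset.range (2 ^ n), algebraMap ℚ_[2] (PadicAlgCl 2) (V j : ℚ_[2]) * ψ (5 : ZMod (2 ^ (n + 2))) ^ j =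
        (∑ j ∈ Finset.range (2 ^ n), ψ (5 : ZMod (2 ^ (n + 2))) ^ j * L j) *
          ∑ b : (ZMod (2 ^ (n + 2)))ˣ, ψ⁻¹ (b : ZMod (2 ^ (n + 2))) * τ (n + 2) (b : ZMod (2 ^ (n + 2))) • e (n + 2) (x (n + 2)) := by
      have h1 : ∑ j ∈ Finset.range (2 ^ n), algebraMap ℚ_[2] (PadicAlgCl 2) (V j : ℚ_[2]) * ψ (5 : ZMod (2 ^ (n + 2))) ^ j =
          ∑ s : ZMod (2 ^ n), ψ (5 : ZMod (2 ^ (n + 2))) ^ s.val *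
            ∑ b : (ZMod (2 ^ (n + 2)))ˣ, τ (n + 2) (b : ZMod (2 ^ (n + 2))) • (g₀ ^ s.val • L 0 * e (n + 2) (x (n + 2))) := by
        rw [CoreChi.sum_range_eq_sum_zmod n
          (fun j ↦ algebraMap ℚ_[2] (PadicAlgCl 2) (V j : ℚ_[2]) * ψ (5 : ZMod (2 ^ (n + 2))) ^ j)]
        refine Finset.sum_congr rfl fun s _ ↦ ?_
        rw [hV, ← hLorb, mul_comm]
      have h2 : ∑ j ∈ Finset.range (2 ^ n), ψ (5 : ZMod (2 ^ (n + 2))) ^ j * L j =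
          ∑ s : ZMod (2 ^ n), ψ (5 : ZMod (2 ^ (n + 2))) ^ s.val * g₀ ^ s.val • L 0 := by
        rw [CoreChi.sum_range_eq_sum_zmod n (fun j ↦ ψ (5 : ZMod (2 ^ (n + 2))) ^ j * L j)]
        refine Finset.sum_congr rfl fun s _ ↦ ?_
        rw [← hLorb]
      rw [h1, h2]
      exact sum_pow_mul_trace_eq_mul n (τ (n + 2)) (hτ (n + 2)) (hζpow (n + 2)) hL0mem hLneg ψ hevenψ
    -- log character sum of the displayed plus Honda point
    have hE2 : ∑ j ∈ Finset.range (2 ^ n), ψ (5 : ZMod (2 ^ (n + 2))) ^ j * L j =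
        3 * gaussSum ψ (AddChar.zmodChar (2 ^ (n + 2)) (HondaLog.zeta_pow_prime_pow_self (p := 2) (n + 2))) := by
      rw [hLdef]
      exact LocalVar.sum_pow_mul_ptLogΩ_pow_smul_plusHondaPoint_eq A hcΩ hcstab hσσ hd₀ n hg₀1 ψ hprimψ hevenψ
    -- Kato's values (VAL) at `ψ`
    have hE4 := hVAL n ψ hevenψ hprimψ
    rw [hψ] at hE4
    -- combine: push the `ℚ̄₂`-identity to `ℂ₂`
    have hS : ∑ j ∈ Finset.range (2 ^ n),
          algebraMap (PadicAlgCl 2) ℂ_[2] (algebraMap ℚ_[2] (PadicAlgCl 2) (V j : ℚ_[2])) * χ (5 : ZMod (2 ^ (n + 2))) ^ j =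
        algebraMap (PadicAlgCl 2) ℂ_[2]
          (∑ j ∈ Finset.range (2 ^ n), algebraMap ℚ_[2] (PadicAlgCl 2) (V j : ℚ_[2]) * ψ (5 : ZMod (2 ^ (n + 2))) ^ j) := by
      rw [map_sum]
      refine Finset.sum_congr rfl fun j _ ↦ ?_
      rw [map_mul, map_pow, hχa]
    rw [hS, hE1, hE2, hχa (5 : ZMod (2 ^ (n + 2)))]
    rw [show (3 : PadicAlgCl 2) * gaussSum ψ (AddChar.zmodChar (2 ^ (n + 2)) (HondaLog.zeta_pow_prime_pow_self (p := 2) (n + 2))) *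
          ∑ b : (ZMod (2 ^ (n + 2)))ˣ, ψ⁻¹ (b : ZMod (2 ^ (n + 2))) * τ (n + 2) (b : ZMod (2 ^ (n + 2))) • e (n + 2) (x (n + 2)) =
        3 * ((∑ b : (ZMod (2 ^ (n + 2)))ˣ, ψ⁻¹ (b : ZMod (2 ^ (n + 2))) * τ (n + 2) (b : ZMod (2 ^ (n + 2))) • e (n + 2) (x (n + 2))) *
          gaussSum ψ (AddChar.zmodChar (2 ^ (n + 2)) (HondaLog.zeta_pow_prime_pow_self (p := 2) (n + 2)))) by ring,
      map_mul, hE4, map_ofNat]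
    push_cast
    rw [← hq]
    ring
  · -- TRIVIAL χ (`n ≤ 1`): the K3 level identity at the trivial character with the twist profile `c = d = 1`
    have hn : n ≤ 1 := hprim'.resolve_left hp
    have h1 : χ = 1 := eq_one_of_even_of_not_isPrimitive hn χ heven hp
    subst h1
    have hlog := logBaseTwo_brick A hcΩ hσσ hd₀ n hn hg₀1
    obtain ⟨hH0, hH1⟩ := heckeBaseTwo_brick f hf0 hQ hN2 hap
    have hH : ratTwistedSymbolSum f (1 : DirichletCharacter ℂ_[2] (2 ^ (n + 2))) =
        (((if n = 0 then (-1 : ℚ) else 4) * ratPlusSymbol f 0 : ℚ) : ℂ_[2]) := by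
      interval_cases n
      · rw [hH0]; push_cast; ring
      · rw [hH1]; push_cast; ring
    have h1u : IsUnit (((1 : ℤ) : ℤ) : ZMod (2 ^ (n + 2))) := by simp
    have hmain := level_identity_trivial f n (cycLevel_two_empty (n + 2)) (e (n + 2)) (he (n + 2)) (τ (n + 2)) (hτ (n + 2))
      (hζpow (n + 2)) L hLorb hL0mem hLneg (x (n + 2)) V hV q 1 1 h1u h1u (ratPlusSymbol f 0) t₀ 0 0 0
      (if n = 0 then (-2 : ℚ) else 8) (if n = 0 then (-1 : ℚ) else 4) (by split_ifs <;> norm_num) ?_ ?_ hH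
    rotate_left
    · rw [hLdef]; exact hlog
    · rw [hTRIV (n + 2) (by omega) (by omega)]; push_cast; ring
    -- the multiplier at the trivial character is its constant coefficient `t₀`
    have h15 : (1 : DirichletCharacter ℂ_[2] (2 ^ (n + 2))) (5 : ZMod (2 ^ (n + 2))) = 1 :=
      MulChar.one_apply (by simpa using KatoBK.isUnit_five_pow (n + 2) 1)
    have hμt1 : ∑' k, ((algebraMap ℚ_[2] ℂ_[2]).comp (algebraMap ℤ_[2] ℚ_[2])) (PowerSeries.coeff k μt) *
        ((1 : DirichletCharacter ℂ_[2] (2 ^ (n + 2))) (5 : ZMod (2 ^ (n + 2))) - 1) ^ k = (t₀ : ℂ_[2]) := by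
      rw [h15, sub_self, tsum_eq_single 0 (fun k hk ↦ by rw [zero_pow hk, mul_zero]), pow_zero, mul_one, hμt0, map_intCast]
    rw [hμt1]
    simp only [h15, one_pow, mul_one] at hmain ⊢
    push_cast at hmain ⊢
    linear_combination hmain

end Summit.BirchSwinnertonDyer.BirchSwinnertonDyer.Theorems.KatoZetaErlKSideCMAtTwo

end
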